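import Literature.IUT.HodgeTheaters.ProfiniteCompletionQuotients
import Mathlib.GroupTheory.FreeGroup.NielsenSchreier
import Mathlib.GroupTheory.RegularWreathProduct
import Mathlib.Data.ZMod.Basic
import HarnessLib

/-!
# [IUTchI] §2 plumbing, IV: finite embedding problems over open subgroups of `Ĝ` (`G` free),
# and the wreath-product obstruction `C_p ≀ C_p`

Mochizuki, *Inter-universal Teichmüller theory I*, kurims manuscript (May 2020), §2, Lemma 2.7 (v),
statement p. 57, proof p. 59 [cite: Mochizuki2012, Lem 2.7(v) p.59] (D-0012 claim key, status disputed —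
the content of this file is plain profinite group theory and takes no side).  The printed proof of
Lemma 2.7 (v) ("`T̂` is normally terminal in `Ĝ`") argues: "If `Z_Ĝ(T̂) ≠ T̂`, then … for some prime
number `l`, there exists a closed [abelian] subgroup `T̂₁ ⊆ Z_Ĝ(T̂)` … such that there exists a continuous
surjection `ℤ_l × ℤ_l ↠ T̂₁` whose kernel lies in `l · (ℤ_l × ℤ_l)`.  In particular, … the `l`-cohomological
dimension of `T̂₁` is `≥ 2`.  On the other hand … [it] is `1`, a contradiction."  The cohomological
dimension of closed subgroups of the free profinite group `Ĝ` is not available in the tree; this file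
supplies an ELEMENTARY replacement for the two halves of that sentence, for `G` a free group
(`IsFreeGroup G`, any rank) and `Ĝ = profiniteCompletion G` (Mathlib's `ProfiniteGrp.ProfiniteCompletion`,
typed by abc-iut-L5-t1 in `DiscreteProfiniteConjugates.lean`):

* "cohomological dimension `≤ 1`" ⇝ `exists_lift_of_surjective` / `exists_lift_of_isOpen`: every OPEN
  subgroup `U ⊆ Ĝ` weakly solves every finite embedding problem — a continuous `ψ : U → B̄` lifts through
  any surjection of finite groups `B ↠ B̄`.  Proof: `η⁻¹(U) ⊆ G` is free (Nielsen–Schreier, Mathlib's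
  `subgroupIsFreeOfIsFree`), lift generator-wise, and extend to `U` through the components at a level
  below `core(Ker) ⊓ N` (the plumbing of parts I–II, abc-iut-L5-t17);
* "`ℤ_l × ℤ_l ↠ (ℤ/l)²` has cohomological dimension `≥ 2`" ⇝ `wreath_not_commute`: in the finite group
  `C_p ≀ C_p` (Mathlib's `RegularWreathProduct`) mapping onto `C_p × C_p` by (`rightHom`, product of the
  coordinates — `exists_wreath_prod_hom`), NO two lifts of the two basis vectors commute; so two COMMUTING
  elements of an open `U ⊆ Ĝ` can never map to a basis of `(ℤ/p)²` under a continuous `U → (ℤ/p)²`.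

Also recorded: the neighbourhood basis `{x | x.val N = 1}` of `1 ∈ Ĝ` (`exists_val_eq_one_subset_of_isOpen`)
and its consequences for open subgroups and continuous maps to discrete groups.  Theorems only; consumed by
`ProfiniteCompletionAbelianSubgroups.lean` (Lemma 2.7 (v), free case).
-/

namespace Literature.IUT.HodgeTheaters.ProfiniteCompletion

open CategoryTheory ProfiniteGrp ProfiniteGrp.ProfiniteCompletion Topology

universe u

variable {G : Type u} [Group G]

/-! ### The neighbourhood basis `{x | x.val N = 1}` of `1 ∈ Ĝ` -/

/-- Triviality of a component propagates to all coarser levels. [cite: Mochizuki2012, Lem 2.7(v) p.59] -/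
theorem val_eq_one_of_le (x : profiniteCompletion G) {N M : FiniteIndexNormalSubgroup G} (h : N ≤ M)
    (hx : x.val N = 1) : x.val M = 1 :=
  val_mk_eq_of_le x h 1 hx

/-- **Neighbourhood basis of `1`.**  Every open subset of `Ĝ` containing `1` contains a "principal
congruence set" `{x | x.val N = 1}` for some finite-index normal `N ⊴ G` (the limit topology is generated
by finitely many levels at a time, and finitely many levels have a common refinement).
[cite: Mochizuki2012, Lem 2.7(v) p.59] -/
theorem exists_val_eq_one_subset_of_isOpen {U : Set (profiniteCompletion G)} (hU : IsOpen U)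
    (h1 : (1 : profiniteCompletion G) ∈ U) :
    ∃ N : FiniteIndexNormalSubgroup G, ∀ x : profiniteCompletion G, x.val N = 1 → x ∈ U := by
  classical
  obtain ⟨s, hsO, rfl⟩ := isOpen_induced_iff.mp hU
  have h1' : (1 : profiniteCompletion G).val ∈ s := h1
  rcases isOpen_pi_iff.mp hsO _ h1' with ⟨J, u, hJ1, hJ2⟩
  -- the finite intersection `M` of the levels in `J`
  let M : Subgroup G := ⨅ j : J, (j : FiniteIndexNormalSubgroup G).toSubgroup
  have hM : M.Normal := Subgroup.normal_iInf_normal fun j => inferInstance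
  have hMFinite : M.FiniteIndex := by
    apply Subgroup.finiteIndex_iInf
    infer_instance
  let Mf : FiniteIndexNormalSubgroup G := { toSubgroup := M }
  refine ⟨Mf, fun x hx => ?_⟩
  change x.val ∈ s
  apply hJ2
  intro a ha
  have hle : Mf ≤ a := fun y hy =>
    (iInf_le (fun j : J => (j : FiniteIndexNormalSubgroup G).toSubgroup) ⟨a, ha⟩ : M ≤ a.toSubgroup) hy
  have hxa : x.val a = 1 := val_eq_one_of_le x hle hx
  rw [hxa]
  exact (hJ1 a ha).2

/-- An open subgroup of `Ĝ` contains a principal congruence subgroup `{x | x.val N = 1}`.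
[cite: Mochizuki2012, Lem 2.7(v) p.59] -/
theorem exists_val_eq_one_mem_of_isOpen {U : Subgroup (profiniteCompletion G)}
    (hU : IsOpen (U : Set (profiniteCompletion G))) :
    ∃ N : FiniteIndexNormalSubgroup G, ∀ x : profiniteCompletion G, x.val N = 1 → x ∈ U :=
  exists_val_eq_one_subset_of_isOpen hU U.one_mem

/-- A continuous homomorphism from a subgroup `U ⊆ Ĝ` to a discrete group kills a principal congruence
subgroup: `x ∈ U`, `x.val N = 1 ⇒ ψ x = 1` for some `N`. [cite: Mochizuki2012, Lem 2.7(v) p.59] -/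
theorem exists_val_eq_one_map_eq_one {U : Subgroup (profiniteCompletion G)} {B : Type*} [Group B]
    [TopologicalSpace B] [DiscreteTopology B] (ψ : U →* B) (hψ : Continuous ψ) :
    ∃ N : FiniteIndexNormalSubgroup G,
      ∀ (x : profiniteCompletion G) (hx : x ∈ U), x.val N = 1 → ψ ⟨x, hx⟩ = 1 := by
  have hO : IsOpen (ψ ⁻¹' {1}) := (isOpen_discrete _).preimage hψ
  obtain ⟨W, hWO, hW⟩ := isOpen_induced_iff.mp hO
  have h1W : (1 : profiniteCompletion G) ∈ W := by
    have : (1 : U) ∈ Subtype.val ⁻¹' W := by rw [hW]; simp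
    exact this
  obtain ⟨N, hN⟩ := exists_val_eq_one_subset_of_isOpen hWO h1W
  refine ⟨N, fun x hx hxN => ?_⟩
  have : (⟨x, hx⟩ : U) ∈ Subtype.val ⁻¹' W := hN x hxN
  rw [hW] at this
  exact this

/-! ### Finite embedding problems over open subgroups of `Ĝ`, `G` free -/

/-- **Lifting lemma (weak solvability of finite embedding problems).**  Let `G` be a free group,
`U ⊆ Ĝ` a subgroup containing a principal congruence subgroup, `α : B ↠ B̄` a surjection from a finite
group, and `ψ : U → B̄` a homomorphism killing a principal congruence subgroup.  Then `ψ` lifts: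
`α ∘ θ = ψ` for some homomorphism `θ : U → B`.  (Proof: `H = η⁻¹(U)` is a free group by Nielsen–Schreier;
lift `ψ ∘ η|_H` generator-wise to `θ₀ : H → B`; extend to `U` by `θ(x) := θ₀(g)` for any `g` representing the
component of `x` at a level below `core(Ker θ₀) ⊓ N`.)  This replaces "the `l`-cohomological dimension of
[a closed subgroup of `Ĝ`] is `1`" in the proof of Lemma 2.7 (v), p. 59. [cite: Mochizuki2012, Lem 2.7(v) p.59] -/
theorem exists_lift_of_surjective [IsFreeGroup G] (U : Subgroup (profiniteCompletion G))
    (hU : ∃ N₁ : FiniteIndexNormalSubgroup G, ∀ x : profiniteCompletion G, x.val N₁ = 1 → x ∈ U)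
    {B Bbar : Type*} [Group B] [Group Bbar] [Finite B]
    (α : B →* Bbar) (hα : Function.Surjective α) (ψ : U →* Bbar)
    (hψ : ∃ N₂ : FiniteIndexNormalSubgroup G,
      ∀ (x : profiniteCompletion G) (hx : x ∈ U), x.val N₂ = 1 → ψ ⟨x, hx⟩ = 1) :
    ∃ θ : U →* B, ∀ x : U, α (θ x) = ψ x := by
  classical
  obtain ⟨N₁, hN₁⟩ := hU
  obtain ⟨N₂, hN₂⟩ := hψ
  -- the discrete subgroup `H = η⁻¹(U)`, free by Nielsen–Schreier
  let H : Subgroup G := U.comap (toCompletion G)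
  let ι : H →* U := ((toCompletion G).comp H.subtype).codRestrict U fun h => h.property
  let ψH : H →* Bbar := ψ.comp ι
  -- lift generator-wise
  have hgen : ∀ a : IsFreeGroup.Generators H, ∃ b : B, α b = ψH (IsFreeGroup.of a) := fun a => hα _
  choose b hb using hgen
  let θ₀ : H →* B := IsFreeGroup.lift b
  have hθ₀ : ∀ h : H, α (θ₀ h) = ψH h := by
    intro h
    have := IsFreeGroup.ext_hom (f := α.comp θ₀) (g := ψH) fun a => by
      simp only [MonoidHom.comp_apply, θ₀, IsFreeGroup.lift_of, hb]
    exact DFunLike.congr_fun this h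
  -- `H` has finite index (it contains `N₁`), hence so does `Ker θ₀` viewed in `G`
  haveI hHfi : H.FiniteIndex := by
    apply Subgroup.finiteIndex_of_le (H := N₁.toSubgroup)
    intro g hg
    change toCompletion G g ∈ U
    apply hN₁
    change (QuotientGroup.mk g : G ⧸ N₁.toSubgroup) = 1
    rw [QuotientGroup.eq_one_iff]
    exact hg
  let K : Subgroup G := θ₀.ker.map H.subtype
  haveI hKfi : K.FiniteIndex := by
    constructor
    rw [Subgroup.index_map_subtype]
    refine mul_ne_zero ?_ hHfi.index_ne_zero
    rw [Subgroup.index_ker]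
    exact Nat.card_pos.ne'
  let M₀ : FiniteIndexNormalSubgroup G := FiniteIndexNormalSubgroup.ofSubgroup K.normalCore
  let M : FiniteIndexNormalSubgroup G := M₀ ⊓ (N₁ ⊓ N₂)
  -- representatives of the `M`-components
  have hrep0 : ∀ x : profiniteCompletion G, ∃ g : G,
      x.val M = (QuotientGroup.mk g : G ⧸ M.toSubgroup) := fun x => by
    obtain ⟨g, hg⟩ := QuotientGroup.mk_surjective (x.val M)
    exact ⟨g, hg.symm⟩
  choose rep hrep using hrep0
  -- (1) a representative of the `M`-component of `x ∈ U` lies in `H`, and `ψ x = ψH` of it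
  have key0 : ∀ (x : profiniteCompletion G) (g : G),
      x.val M = (QuotientGroup.mk g : G ⧸ M.toSubgroup) → (x⁻¹ * toCompletion G g).val M = 1 := by
    intro x g hg
    have e : (x⁻¹ * toCompletion G g).val M = (x.val M)⁻¹ * (toCompletion G g).val M := rfl
    rw [e, hg]
    exact inv_mul_cancel _
  have key1 : ∀ (x : profiniteCompletion G), x ∈ U → ∀ g : G,
      x.val M = (QuotientGroup.mk g : G ⧸ M.toSubgroup) → g ∈ H := by
    intro x hx g hg
    have hy : x⁻¹ * toCompletion G g ∈ U :=
      hN₁ _ (val_eq_one_of_le _ (inf_le_right.trans inf_le_left) (key0 x g hg))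
    have := U.mul_mem hx hy
    rwa [mul_inv_cancel_left] at this
  have key2 : ∀ (x : profiniteCompletion G) (hx : x ∈ U) (g : G)
      (hg : x.val M = (QuotientGroup.mk g : G ⧸ M.toSubgroup)),
      ψ ⟨x, hx⟩ = ψH ⟨g, key1 x hx g hg⟩ := by
    intro x hx g hg
    have hy : x⁻¹ * toCompletion G g ∈ U :=
      hN₁ _ (val_eq_one_of_le _ (inf_le_right.trans inf_le_left) (key0 x g hg))
    have hψy : ψ ⟨x⁻¹ * toCompletion G g, hy⟩ = 1 :=
      hN₂ _ hy (val_eq_one_of_le _ (inf_le_right.trans inf_le_right) (key0 x g hg))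
    have hprod : (⟨x, hx⟩ : U) * ⟨x⁻¹ * toCompletion G g, hy⟩ = ι ⟨g, key1 x hx g hg⟩ :=
      Subtype.ext (mul_inv_cancel_left x (toCompletion G g))
    calc ψ ⟨x, hx⟩ = ψ ⟨x, hx⟩ * ψ ⟨x⁻¹ * toCompletion G g, hy⟩ := by rw [hψy, mul_one]
      _ = ψ (ι ⟨g, key1 x hx g hg⟩) := by rw [← map_mul, hprod]
      _ = ψH ⟨g, key1 x hx g hg⟩ := rfl
  -- (2) `θ₀` is constant on `M`-cosets
  have key3 : ∀ g g' : H, ((g : G)⁻¹ * g' ∈ M.toSubgroup) → θ₀ g = θ₀ g' := by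
    intro g g' hgg'
    have hK : (g : G)⁻¹ * g' ∈ K := K.normalCore_le ((inf_le_left : M ≤ M₀) hgg')
    obtain ⟨k, hk, hkg⟩ := Subgroup.mem_map.mp hK
    have hk' : k = g⁻¹ * g' := Subtype.ext (by simpa using hkg)
    rw [hk', MonoidHom.mem_ker, map_mul, map_inv, inv_mul_eq_one] at hk
    exact hk
  -- (3) the lift
  let θf : U → B := fun x => θ₀ ⟨rep x.1, key1 x.1 x.2 (rep x.1) (hrep x.1)⟩
  have θmul : ∀ x y : U, θf (x * y) = θf x * θf y := by
    intro x y
    change θ₀ _ = θ₀ _ * θ₀ _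
    rw [← map_mul]
    apply key3
    change (rep (x.1 * y.1))⁻¹ * (rep x.1 * rep y.1) ∈ M.toSubgroup
    rw [← QuotientGroup.eq, QuotientGroup.mk_mul, ← hrep x.1, ← hrep y.1, ← hrep (x.1 * y.1)]
    rfl
  refine ⟨MonoidHom.mk' θf θmul, fun x => ?_⟩
  change α (θ₀ _) = ψ x
  rw [hθ₀]
  exact (key2 x.1 x.2 (rep x.1) (hrep x.1)).symm

/-- Topological form of the lifting lemma: for `G` free, an OPEN subgroup `U ⊆ Ĝ`, a surjection of finite
groups `α : B ↠ B̄` (`B̄` discrete) and a CONTINUOUS homomorphism `ψ : U → B̄`, there is `θ : U → B` with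
`α ∘ θ = ψ` — i.e. open subgroups of the free profinite group `Ĝ` weakly solve all finite embedding
problems ("cohomological dimension `≤ 1`", p. 59, in elementary form). [cite: Mochizuki2012, Lem 2.7(v) p.59] -/
theorem exists_lift_of_isOpen [IsFreeGroup G] (U : Subgroup (profiniteCompletion G))
    (hU : IsOpen (U : Set (profiniteCompletion G)))
    {B Bbar : Type*} [Group B] [Group Bbar] [Finite B] [TopologicalSpace Bbar] [DiscreteTopology Bbar]
    (α : B →* Bbar) (hα : Function.Surjective α) (ψ : U →* Bbar) (hψ : Continuous ψ) :
    ∃ θ : U →* B, ∀ x : U, α (θ x) = ψ x :=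
  exists_lift_of_surjective U (exists_val_eq_one_mem_of_isOpen hU) α hα ψ
    (exists_val_eq_one_map_eq_one ψ hψ)

/-! ### The obstruction `C_p ≀ C_p ↠ C_p × C_p` -/

section Wreath

variable (p : ℕ) [hp : Fact p.Prime]

/-- The "product of the coordinates" homomorphism `C_p ≀ C_p → C_p`, `(f, q) ↦ ∏_t f(t)` (a homomorphism
because the twist in the wreath product only PERMUTES the coordinates). [cite: Mochizuki2012, Lem 2.7(v) p.59] -/
theorem exists_wreath_prod_hom :
    ∃ σ : (Multiplicative (ZMod p) ≀ᵣ Multiplicative (ZMod p)) →* Multiplicative (ZMod p),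
      ∀ w, σ w = ∏ t, w.left t := by
  haveI : NeZero p := ⟨hp.out.ne_zero⟩
  refine ⟨MonoidHom.mk' (fun w => ∏ t, w.left t) fun a b => ?_, fun w => rfl⟩
  simp only [RegularWreathProduct.mul_left, Pi.mul_apply, Finset.prod_mul_distrib]
  congr 1
  exact Fintype.prod_equiv (Equiv.mulLeft a.right⁻¹) _ _ fun t => rfl

/-- The pair (`rightHom`, product of coordinates) `C_p ≀ C_p → C_p × C_p` is surjective.
[cite: Mochizuki2012, Lem 2.7(v) p.59] -/
theorem wreath_pair_surjective
    (σ : (Multiplicative (ZMod p) ≀ᵣ Multiplicative (ZMod p)) →* Multiplicative (ZMod p))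
    (hσ : ∀ w, σ w = ∏ t, w.left t) :
    Function.Surjective (RegularWreathProduct.rightHom.prod σ) := by
  classical
  haveI : NeZero p := ⟨hp.out.ne_zero⟩
  rintro ⟨q, d⟩
  refine ⟨⟨Pi.mulSingle 1 d, q⟩, ?_⟩
  simp only [MonoidHom.prod_apply, hσ, Fintype.prod_pi_mulSingle']
  rfl

/-- **No two lifts of the basis vectors commute.**  In `C_p ≀ C_p`, an element `x` with `rightHom x = 1̄`
(the generator `ofAdd 1` of `C_p`) and an element `y` with `rightHom y = 1` (trivial) whose coordinates
multiply to the generator never commute: commuting would force the coordinate function of `y` to be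
translation invariant, i.e. constant, whose product is then a `p`-th power, i.e. trivial.  (The finite
shadow of "`ℤ_l × ℤ_l` has cohomological dimension `2`", p. 59.) [cite: Mochizuki2012, Lem 2.7(v) p.59] -/
theorem wreath_not_commute (x y : Multiplicative (ZMod p) ≀ᵣ Multiplicative (ZMod p))
    (hx : x.right = Multiplicative.ofAdd 1) (hy : y.right = 1)
    (hy' : ∏ t, y.left t = Multiplicative.ofAdd 1) : x * y ≠ y * x := by
  haveI : NeZero p := ⟨hp.out.ne_zero⟩
  intro hxy
  have hl := congrArg RegularWreathProduct.left hxy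
  simp only [RegularWreathProduct.mul_left, hy, inv_one, one_mul] at hl
  -- translation invariance of `y.left`
  have hinv : ∀ t, y.left (x.right⁻¹ * t) = y.left t := by
    intro t
    have h := congrFun hl t
    simp only [Pi.mul_apply] at h
    rw [mul_comm (y.left t)] at h
    exact mul_left_cancel h
  have hiter : ∀ (n : ℕ) (t), y.left (x.right⁻¹ ^ n * t) = y.left t := by
    intro n
    induction n with
    | zero => intro t; rw [pow_zero, one_mul]
    | succ n ih => intro t; rw [pow_succ, mul_assoc, ih, hinv]
  -- hence `y.left` is constant
  have hconst : ∀ t, y.left t = y.left 1 := by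
    intro t
    have h := hiter (-(Multiplicative.toAdd t)).val 1
    rw [mul_one, hx, ← ofAdd_neg, ← ofAdd_nsmul, smul_neg, nsmul_eq_mul, mul_one,
      ZMod.natCast_zmod_val, neg_neg, ofAdd_toAdd] at h
    exact h
  -- so the product of its coordinates is a `p`-th power, i.e. trivial
  have hprod : ∏ t, y.left t = 1 := by
    rw [Finset.prod_congr rfl fun t _ => hconst t, Finset.prod_const, Finset.card_univ,
      Fintype.card_multiplicative, ZMod.card, ← ofAdd_toAdd (y.left 1), ← ofAdd_nsmul, nsmul_eq_mul,
      ZMod.natCast_self, zero_mul, ofAdd_zero]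
  rw [hprod] at hy'
  have h01 := congrArg Multiplicative.toAdd hy'
  rw [toAdd_one, toAdd_ofAdd] at h01
  exact zero_ne_one h01

end Wreath

end Literature.IUT.HodgeTheaters.ProfiniteCompletion
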